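import Mathlib
import Literature.NumberTheory.Transcendental.BlochWignerDilogarithm
import Literature.NumberTheory.Transcendental.BlochWignerCircle
import Summits.KontsevichZagierPeriods.KontsevichZagierPeriods.Theorems.HyperbolicBlochZagierDilogarithmConjectureStubClausenCharSumPrimitive
import HarnessLib

/-!
# `ZagierDilogarithmConjecture` (stmt-KontsevichZagierPeriods-10550) — line
`kummer-clausen-linearisation` (reshape c4, "the cyclotomic sector, exactly"), stub
`stub_clausenLobachevsky`

**Clausen values are Lobachevsky values.** Let `ζ_N = exp(2πi/N)`, `D` the Bloch–Wigner
dilogarithm (`blochWignerDilog`) and `Л(θ) = −∫₀^θ log|2 sin u| du` Milnor's Lobachevsky function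
(`lobachevsky`). For `0 < c < N`,
`D(ζ_N^c) = 2 · Л(πc/N)`,
so Milnor's conjecture in its printed form (the `Л(πc/N)`, `(c, N) = 1`, `0 < c < N/2`, are
`ℚ`-linearly independent) is literally the statement about the Clausen values `D(ζ_N^c)` used by
the line's `crux_implies_milnor`.

Proof (what / why).
* `ζ_N^c = e^{iθ}` with `θ = 2πc/N` (the landed `cexp_two_pi_div_pow` of the line's file
  `…StubClausenCharSumPrimitive`, `Complex.exp_nat_mul`).
* `0 < c < N` gives `0 < θ < 2π`, so the tree's Clausen integral
  (`integral_log_abs_two_sin_half_of_pos`, file `BlochWignerCircle`) reads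
  `∫₀^θ log|2 sin(t/2)| dt = −D(e^{iθ})`.
* `ClausenLobachevsky.integral_log_abs_two_sin_half_eq`: the substitution `t = 2u`
  (`intervalIntegral.integral_comp_div`) gives `∫₀^θ log|2 sin(t/2)| dt = 2 ∫₀^{θ/2} log|2 sin u| du`,
  i.e. `= −2 · Л(θ/2)` by `lobachevsky_def`; hence `D(ζ_N^c) = 2 Л(θ/2) = 2 Л(πc/N)`.
Mathlib + the tree's dilogarithm files only; sorry-free; axioms ⊆ {propext, Classical.choice,
Quot.sound}.

## References

* J. Milnor, *Hyperbolic geometry: the first 150 years*, Bull. AMS 6 (1982), Appendix, p. 17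
  (definition of `Л`) and Lemma 1 (`Л` odd, `π`-periodic, `2Л(θ) = Σ_{n ≥ 1} sin(2nθ)/n²`).
  [Milnor1982]
* D. H. Bailey, J. M. Borwein, D. Broadhurst, W. Zudilin, *Experimental mathematics and
  mathematical physics*, Contemp. Math. 517 (2010), §5 eq. (15) (`Cl₂(θ) = −∫₀^θ log|2 sin σ| dσ`).
  [BaileyEtAl2010]
-/

noncomputable section

open scoped BigOperators
open Literature.NumberTheory.Transcendental

namespace Summit.KontsevichZagierPeriods.HyperbolicBloch.ZagierDilogarithmCyclotomic

namespace ClausenLobachevsky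

/-- The substitution `t = 2u` in the Clausen integral:
`∫₀^θ log|2 sin(t/2)| dt = 2 ∫₀^{θ/2} log|2 sin u| du`. [folklore] -/
theorem integral_log_abs_two_sin_half_eq (θ : ℝ) :
    ∫ t in (0 : ℝ)..θ, Real.log |2 * Real.sin (t / 2)| =
      2 * ∫ u in (0 : ℝ)..θ / 2, Real.log |2 * Real.sin u| := by
  have := intervalIntegral.integral_comp_div (a := (0 : ℝ)) (b := θ)
    (fun s : ℝ => Real.log |2 * Real.sin s|) (two_ne_zero)
  simpa using this

/-- `D(e^{iθ}) = 2 · Л(θ/2)` for `0 < θ < 2π` (the Clausen integral and the substitution `t = 2u`).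
[folklore] -/
theorem blochWignerDilog_exp_eq_two_mul_lobachevsky {θ : ℝ} (h0 : 0 < θ) (h2 : θ < 2 * Real.pi) :
    blochWignerDilog (Complex.exp (θ * Complex.I)) = 2 * lobachevsky (θ / 2) := by
  have hClausen := integral_log_abs_two_sin_half_of_pos h0 h2
  have hsub := integral_log_abs_two_sin_half_eq θ
  rw [lobachevsky_def]
  linarith

end ClausenLobachevsky

open ClausenLobachevsky

/-- **Clausen values are Lobachevsky values** (stub `stub_clausenLobachevsky`). For `0 < c < N`,
`D(ζ_N^c) = 2 · Л(πc/N)`, where `ζ_N = exp(2πi/N)`, `D` is the Bloch–Wigner dilogarithm and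
`Л(θ) = −∫₀^θ log|2 sin u| du` is Milnor's Lobachevsky function: `D(e^{iθ}) = −∫₀^θ log|2 sin(t/2)| dt`
for `θ = 2πc/N ∈ (0, 2π)`, and the substitution `t = 2u`. Hence Milnor's conjecture in its printed
form (the `Л(πc/N)`, `(c, N) = 1`, `0 < c < N/2`, are `ℚ`-independent) is literally the statement
about the `D(ζ_N^c)`. [cite: Milnor1982, Appendix, Lemma 1] -/
theorem stub_clausenLobachevsky :
    ∀ (N c : ℕ), 0 < c → c < N →
      blochWignerDilog (Complex.exp (2 * Real.pi * Complex.I / N) ^ c) =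
        2 * lobachevsky (Real.pi * c / N) := by
  intro N c hc hcN
  have hN : (0 : ℝ) < N := Nat.cast_pos.mpr (hc.trans hcN)
  have hc' : (0 : ℝ) < c := Nat.cast_pos.mpr hc
  have hcN' : (c : ℝ) < N := Nat.cast_lt.mpr hcN
  have h0 : (0 : ℝ) < 2 * Real.pi * c / N := by positivity
  have h2 : 2 * Real.pi * c / N < 2 * Real.pi := by
    rw [div_lt_iff₀ hN]
    exact mul_lt_mul_of_pos_left hcN' (by positivity)
  rw [cexp_two_pi_div_pow N c, blochWignerDilog_exp_eq_two_mul_lobachevsky h0 h2,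
    show 2 * Real.pi * c / N / 2 = Real.pi * c / N by ring]

end Summit.KontsevichZagierPeriods.HyperbolicBloch.ZagierDilogarithmCyclotomic

end
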